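import Summits.HodgeConjecture.HodgeConjecture.Theorems.R90S6EtaGraphTwoPartner         -- ★ W10 (E.5) (p02): `etaGraphTwoPartnerAlgHom` (rank-2 η̂), `graph_etaGraphTwoPartnerAlgHom`
import Summits.HodgeConjecture.HodgeConjecture.Theorems.R90S6SatakeCoeffGraphPartner    -- ★ B3 (p04): `prod_zpow_param_two`, `laurentEvalAt_eq_laurentEvalAt_line_two` (brings ★ `eq_of_forall_laurentEvalAt_eq`, ★ `eq_linear_two_of_rev`)
import HarnessLib

/-!
# R90 · S6 «Ch. 14.1–14.5 stable trace formula» — card TE2 (DAG rows E1.4.4.1.2 rank 2 ∕ E1.4.4.3.2): SATAKE COEFFICIENTS OF THE RANK-2 `η̂`-PARTNER ON THE NORM FIBRE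
# `(𝒮(η̂ φ₂))_{ℓ′_k} = Σ_{μ : μ₀ − μ₁ = k} (𝒮^{GL₂}_{wt} φ₂)_μ` for all `k ∈ ℤ` — UNSIGNED (`Theorems/R90S6SatakeCoeffEtaTwoPartner.lean`)

Cell `hodgecm-mathlib`, crux H413 (`stmt-HodgeConjecture-24833`), route of record `HCCMUnconditional`; programme R90-TF (brief `director/R90-BRIEF.v2.md`
1f40d54518340a35), section S6 (base `R90-C14`, dealer R90-C14-plan (g2)), seat R90-C14-p04 (g2); CARD TE2 dealt BY NAME 2026-09-05T01:46:04Z ∕ 01:52:32Z (R90 bus) — the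
`n = 2` clone of ★ TE3 `R90S6SatakeCoeffEtaOnePartner` for p02's ★ W10 (E.5) `etaGraphTwoPartnerAlgHom`; also hands p02's W10-j (J.4) its ROAD A (the `U(2)`-coefficients of `η̂ E_a`
read off the `GL₂` Satake coefficients).  Lane `--kind proof --supports stmt-HodgeConjecture-24833 --as helper`; THEOREMS ONLY over ★ carriers (no definition, no instance, no
notation, no named fact, no kit, no `sorry`).

## THE PRINT
[Rogawski1990, §4.11 Prop. 4.11.1 (b)(c) p. 59]: for `G̃ = Res_{E∕F} U(2)`, `η̂_j : ℋ(G̃, ω̃) → ℋ(G, ωμ^{1−j})` and `Tr(π̃(φ)π̃(ε)) = Tr(i_G(χ)(η̂₁ φ))`, `π̃ = i_{G̃}(χ ∘ N)`;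
`(χ_z ∘ N)(d(x, y)) = χ_z(d(x∕ȳ, y∕x̄)) = z^{val x − val y}`, so the `GL₂`-parameter is `(z, z⁻¹)` and the norm on exponents is `μ ↦ μ₀ − μ₁`.  The tree's ★ W10 (E.5)
`etaGraphTwoPartnerAlgHom` IS this map (spherically `η̂₁² = η̂₂²`), DEFINED by the graph `λ^{GL₂}_{(z,z⁻¹)}(φ₂) = λ^{U(2)}_{(z,1)}(η̂ φ₂)` (★ `graph_etaGraphTwoPartnerAlgHom`).
[CartierCorvallis1979, §IV (4.2)–(4.4)]: `λ_β(f) = (𝒮f)(β)`; `𝒮(η̂φ₂)` is supported on the `U(1,1)` line `ℓ′_k = (k,−k)` (antisymmetry), on which `(z,1)` reads `x^{ℓ′_k} ↦ z^k`;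
comparing coefficients gives the HEAD.  Both transforms carry their `δ^{1∕2}`-weights inside (`wt` with `((2:ℕ):ℤ) − 1`, resp. `satakeWeight`), so no stray factor and no sign.

## WHAT IS PROVED
* §1 **`laurentEvalAt_bcLineTwo_eq_laurentEvalAt_normFibre`** — for every `P ∈ ℂ[ℤ²]`: `ev_{(z,z⁻¹)}(P) = ev_{(z,1)}(Σ_{μ ∈ supp P} x^{ℓ′_{μ₀−μ₁}} · P_μ)` (the rank-2
  base-change line = the norm fibre-sum `μ ↦ μ₀ − μ₁` pushed onto the `U(1,1)` line; twin of ★ TE3 `laurentEvalAt_bcLine_eq_laurentEvalAt_normFibre_two`).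
* §2 HEAD **`coeff_satakeTransform_etaGraphTwoPartner`** (adic place `w ∣ v` inert, `E_w∕F_v` unramified; `U`-binders `c hc1 v w hw hv` = ★ W3 ∕ W10, ANY datum `hd`; `GL₂`-binders
  = ★ W10 (E.5) VERBATIM): for every `φ₂ ∈ ℋ(GL₂(K), GL₂(𝒪))` and every `k ∈ ℤ`, `(hd.satakeTransform (η̂ φ₂))_{ℓ′_k} = Σ_{μ ∈ supp(𝒮^{GL₂}_{wt} φ₂), μ₀ − μ₁ = k} (𝒮^{GL₂}_{wt} φ₂)_μ`.
  Proof = ★ TE3's transport: the graph through `laurentEvalAt` (GL side by `rfl`, U side by ★ `unitaryHeckeEigencharacterAdic_eq` + ★ `heckeEigencharacter_apply`), §1, ★ B3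
  `laurentEvalAt_eq_laurentEvalAt_line_two`, ★ `eq_of_forall_laurentEvalAt_eq`, coefficient at `ℓ′_k`.
KILL-CHECK (structural, by hand): `φ₂ = 1` ⇒ `𝒮^{GL₂}_{wt} 1 = x^0` and `η̂ 1 = 1`, `𝒮 1 = x^0` ⇒ both sides are `[k = 0]` ✓; the value-level digits against p02's (J.1)
`η̂ T₁ = φ′₁ + (−(q−1))•1` need the `wt`-weighted `GL₂` coefficients of `T₁` (p02's ★ `R90S6GLTwoPieri` letters) — the consumer's (J.4) check, not asserted here.
HONEST LABEL: local Hecke coefficient algebra over ★ carriers; proves no printed global statement and no orbital-integral identity (the rank-2 twisted FL, L. 11.5.3 ∕ Prop. 4.11.1 (b),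
stays FLOOR), discharges no citation; count-neutral helper until rows E1.4.4.3.2 ∕ W10-j consume it.  HC_CM is proved only modulo the 7 printed citations (2 remaining named inputs:
hLiu418 = stmt-HodgeConjecture-24832, h413 = stmt-HodgeConjecture-24833) until rung 0 closes; REL ≠ ★ ≠ BUILT.

## Tree search (dedup)
`rg "SatakeCoeffEtaTwoPartner|coeff_satakeTransform_etaGraphTwoPartner|laurentEvalAt_bcLineTwo"` over `lean/` — no hit (2026-09-05T01:53Z); REUSED ★: `graph_etaGraphTwoPartnerAlgHom`
[R90S6EtaGraphTwoPartner], B3 `prod_zpow_param_two` ∕ `laurentEvalAt_eq_laurentEvalAt_line_two`, `eq_of_forall_laurentEvalAt_eq`, `coeff_satakeTransform_eq_zero_of_ne_neg`,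
`eq_linear_two_of_rev`, `unitaryHeckeEigencharacterAdic_eq`, `heckeEigencharacter_apply` (U and GL).

## References
* [Rogawski1990] J. D. Rogawski, *Automorphic Representations of Unitary Groups in Three Variables*, Ann. of Math. Stud. 123 (1990): §4.11 Prop. 4.11.1 (b)(c) p. 59;
  §11.5 L. 11.5.3 p. 155.
* [CartierCorvallis1979] P. Cartier, *Representations of 𝔭-adic groups: a survey*, PSPM 33.1 (1979): §IV (4.2)–(4.4), Thm. 4.1, Cor. 4.2.
-/

set_option autoImplicit false
-- the mandated namespace repeats the single-problem summit's segment (`HodgeConjecture.HodgeConjecture`)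
set_option linter.dupNamespace false

noncomputable section

open scoped Valued WithZero Matrix MatrixGroups
open NumberField IsDedekindDomain ValuativeRel
open Literature.NumberTheory.Automorphic Literature.NumberTheory.Automorphic.HermitianLattice Literature.NumberTheory.Automorphic.UnitaryGroup

namespace Summit.HodgeConjecture.HodgeConjecture.R90.S6

universe u

/-! ## §1 The rank-2 base-change line of `ℂ[ℤ²]` as the norm fibre-sum on the `U(1,1)` line -/

section Line

/-- **`ev_{(z,z⁻¹)}(P) = ev_{(z,1)}(Σ_{μ ∈ supp P} x^{ℓ′_{μ₀−μ₁}}·P_μ)` for every `P ∈ ℂ[ℤ²]`**: the rank-2 base-change parameter `(z, z⁻¹)` reads `x^μ ↦ z^{μ₀−μ₁}` (the norm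
`d(x,y) ↦ d(x∕ȳ, y∕x̄)` on exponents), and the `U(1,1)` parameter `(z, 1)` reads `x^{ℓ′_k} ↦ z^k` (★ B3 `prod_zpow_param_two`). [cite: Rogawski1990, §4.11 Prop. 4.11.1 (c) p. 59]
[cite: CartierCorvallis1979, §IV (4.2)] -/
theorem laurentEvalAt_bcLineTwo_eq_laurentEvalAt_normFibre (P : AddMonoidAlgebra ℂ (Fin 2 → ℤ)) (z : ℂˣ) :
    laurentEvalAt ![z, z⁻¹] P =
      laurentEvalAt ![z, 1] (∑ μ ∈ P.coeff.support,
        AddMonoidAlgebra.single (fun i : Fin 2 => (μ 0 - μ 1) * (1 - 2 * ((i : ℕ) : ℤ))) (P.coeff μ)) := by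
  classical
  conv_lhs => rw [← AddMonoidAlgebra.sum_coeff_single P, map_finsuppSum, Finsupp.sum]
  rw [map_sum]
  refine Finset.sum_congr rfl fun μ _ => ?_
  rw [laurentEvalAt_single, laurentEvalAt_single, prod_zpow_param_two, Fin.prod_univ_two]
  simp only [Fin.isValue, Fin.val_zero, Nat.cast_zero, mul_zero, sub_zero, mul_one, Matrix.cons_val_zero, Matrix.cons_val_one,
    Units.val_inv_eq_inv_val, inv_zpow', zpow_sub₀ (Units.ne_zero z), div_eq_mul_inv, zpow_neg]

end Line

/-! ## §2 The Satake coefficients of the rank-2 `η̂ φ₂` are the norm-fibre sums of the `GL₂` Satake coefficients of `φ₂` -/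

section Adic

variable {F E : Type} [Field F] [NumberField F] [Field E] [NumberField E] [Algebra F E] [Algebra.IsQuadraticExtension F E]
  (c : E ≃ₐ[F] E) (hc1 : c ≠ 1) (v : HeightOneSpectrum (𝓞 F)) (w : PlacesOver E v) (hw : c • w.1 = w.1)
  (hv : Algebra.IsUnramifiedIn (𝓞 E) v.asIdeal)
  {K : Type u} [Field K] [ValuativeRel K] [IsDiscreteValuationRing 𝒪[K]] [Finite 𝓀[K]] {ϖ : K}
  [IsHeckeTriple (⊤ : Submonoid (GL (Fin 2) K)) (glInt 2 K) (glInt 2 K)]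
  (hϖ : IsUniformizingElement ϖ) {u : ℂˣ} (hu : (u : ℂ) ^ 2 = ((Nat.card 𝓀[K] : ℕ) : ℂ))
  {wt : Multiplicative (Fin 2 → ℤ) →* ℂ}
  (hwt : ∀ e : Fin 2 → ℤ, wt (Multiplicative.ofAdd e) = ((u ^ ((((2 : ℕ) : ℤ) - 1) * (∑ i, e i) - 2 * satakeTwistExp e) : ℂˣ) : ℂ))

-- (raised heartbeat budget: the adic `heckeAlgebra` carrier at `E_w` vs the generic-`K` carrier of the ★ Satake files agree only up to instance-path unfolding; each such
--  unification is costly — as in ★ W3-a, ★ B3, ★ TB3, ★ TE3; no `decide`, no search)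
set_option maxHeartbeats 800000 in
/-- **TE2 HEAD — SATAKE COEFFICIENTS OF THE RANK-2 `η̂`-PARTNER ON THE NORM FIBRE (UNSIGNED).**  At an inert place `w ∣ v` with `E_w∕F_v` unramified, for every
`φ₂ ∈ ℋ(GL₂(K), GL₂(𝒪))` (the `GL₂`-side over any DVR field `K` with the `δ^{1∕2}`-weight `wt` of ★ W10 (E.5)), every unramified datum `hd` at `w` and every `k ∈ ℤ`:
`(𝒮(η̂ φ₂))_{ℓ′_k} = Σ_{μ ∈ supp(𝒮^{GL₂}_{wt} φ₂), μ₀ − μ₁ = k} (𝒮^{GL₂}_{wt} φ₂)_μ`, `ℓ′_k = (k, −k)`.  Proof: ★ `graph_etaGraphTwoPartnerAlgHom` read through `laurentEvalAt`, §1, ★ B3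
`laurentEvalAt_eq_laurentEvalAt_line_two`, ★ `eq_of_forall_laurentEvalAt_eq`, coefficient at `ℓ′_k`.
[cite: Rogawski1990, §4.11 Prop. 4.11.1 (b)(c) p. 59] [cite: CartierCorvallis1979, §IV (4.2)–(4.4), Thm. 4.1, Cor. 4.2] -/
theorem coeff_satakeTransform_etaGraphTwoPartner {ϖE : w.1.adicCompletion E}
    (hd : UnramifiedLocalConjDatum (galAdicCompletionMap (L := E) c hw) ϖE) (φ : heckeAlgebra ℂ (GL (Fin 2) K) (glInt 2 K)) (k : ℤ) :
    (hd.satakeTransform (etaGraphTwoPartnerAlgHom c hc1 v w hw hv hϖ hu hwt φ)).coeff (fun i : Fin 2 => k * (1 - 2 * ((i : ℕ) : ℤ))) =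
      ∑ μ ∈ ((isIwasawaExponent_gl (n := 2) hϖ).satakeTransform wt φ).coeff.support with μ 0 - μ 1 = k,
        ((isIwasawaExponent_gl (n := 2) hϖ).satakeTransform wt φ).coeff μ := by
  classical
  haveI := finite_residueField_adicCompletion E w.1
  set P := (isIwasawaExponent_gl (n := 2) hϖ).satakeTransform wt φ with hP
  set F₂ := hd.satakeTransform (etaGraphTwoPartnerAlgHom c hc1 v w hw hv hϖ hu hwt φ) with hF₂
  -- the `U(1,1)` Satake transform is supported on the line `ℓ′_k`
  have hanti : ∀ μ, F₂.coeff μ ≠ 0 → μ = fun i : Fin 2 => μ 0 * (1 - 2 * ((i : ℕ) : ℤ)) := fun μ hμ =>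
    eq_linear_two_of_rev μ fun i => by
      by_contra hne
      exact hμ (hd.coeff_satakeTransform_eq_zero_of_ne_neg _ hne)
  -- the norm-fibre transport of the `GL₂` Satake polynomial onto the `U(1,1)` line
  set G : AddMonoidAlgebra ℂ (Fin 2 → ℤ) :=
    ∑ μ ∈ P.coeff.support, AddMonoidAlgebra.single (fun i : Fin 2 => (μ 0 - μ 1) * (1 - 2 * ((i : ℕ) : ℤ))) (P.coeff μ) with hG
  have hsuppG : ∀ ν, G.coeff ν ≠ 0 → ν = fun i : Fin 2 => ν 0 * (1 - 2 * ((i : ℕ) : ℤ)) := by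
    intro ν hν
    rw [hG, AddMonoidAlgebra.coeff_sum, Finsupp.finsetSum_apply] at hν
    obtain ⟨μ, -, hμν⟩ := Finset.exists_ne_zero_of_sum_ne_zero hν
    rw [AddMonoidAlgebra.coeff_single, Finsupp.single_apply] at hμν
    split_ifs at hμν with hμ
    · rw [← hμ]
      funext i
      simp only [Fin.isValue, Fin.val_zero, Nat.cast_zero, mul_zero, sub_zero, mul_one]
    · exact absurd rfl hμν
  -- the graph identity: `ev_{(z,1)} F₂ = ev_{(z,z⁻¹)} P = ev_{(z,1)} G`
  have hgraph : ∀ z : ℂˣ, laurentEvalAt ![z, 1] F₂ = laurentEvalAt ![z, 1] G := by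
    intro z
    have hg := graph_etaGraphTwoPartnerAlgHom c hc1 v w hw hv hϖ hu hwt φ z
    rw [unitaryHeckeEigencharacterAdic_eq c hc1 v w hw hv hd, hd.heckeEigencharacter_apply,
      (isIwasawaExponent_gl (n := 2) hϖ).heckeEigencharacter_apply] at hg
    rw [hG, ← laurentEvalAt_bcLineTwo_eq_laurentEvalAt_normFibre P z]
    exact hg.symm
  -- hence `F₂ = G`
  have hFG : F₂ = G :=
    eq_of_forall_laurentEvalAt_eq fun β => by
      rw [laurentEvalAt_eq_laurentEvalAt_line_two F₂ hanti β, laurentEvalAt_eq_laurentEvalAt_line_two G hsuppG β, hgraph]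
  -- read off the coefficient at `ℓ′_k`
  rw [hFG, hG, AddMonoidAlgebra.coeff_sum, Finsupp.finsetSum_apply, Finset.sum_filter]
  refine Finset.sum_congr rfl fun μ _ => ?_
  rw [AddMonoidAlgebra.coeff_single, Finsupp.single_apply]
  by_cases hk : μ 0 - μ 1 = k
  · rw [if_pos (by rw [hk]), if_pos hk]
  · rw [if_neg hk, if_neg]
    intro h
    apply hk
    have h0 := congrFun h 0
    simpa using h0

end Adic

end Summit.HodgeConjecture.HodgeConjecture.R90.S6

end
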